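import Summits.CriticalPhenomena.PercolationContinuityZ3.Theorems.PercNearOneGluingNoHeavyQuantShapeForestTwoLo
import Summits.CriticalPhenomena.PercolationContinuityZ3.Theorems.PercNearOneGluingNoHeavyQuantHullHighCons
import HarnessLib

/-!
# QUANT lane R8, T-DEC: THE SIBLING STEP HOLDS OUTRIGHT FOR EVERY FOREST WHOSE HARD CORE IS ONE OF THE CLOSED FAMILIES — any number of TAME or
# HULL+HIGH siblings (any sub-trees) around a core of one-shape glued siblings `R^lo(R^K)`, `K ≤ 2lo`, or around a core of 3-chains / glued children
# (census-1 gen 32; assembles census-1 g31/g32's families with arm-1 g57's `sdec_cons_of_tame` and `sdec_cons_of_hullHigh`)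

builds on p205010 (kernel theorem, internal audit signed; external expert review pending)

Support file (`--supports stmt-CriticalPhenomena-4575`), QUANT lane seat prim-quant-census-1 (gen 32); memo
`run/shared/lean/prim/quant/prim-quant-census-1/g32/TWOLO-G32.md` §2.  Theorems only (no definitions), standard axioms, no sorries.

WHY.  After arm-1 g57 (`sdec_cons_of_tame` ✓ `…QuantCompSlice`, `sdec_cons_of_hullHigh` ✓ `…QuantHullHighCons`) a TAME sibling (every charged count light
or floored) and a sibling with a HULL+HIGH decomposable gated law (census-1 g29) can each be ADJOINED to any SDEC forest, so — `flaw` being a commutative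
convolution — the node `SiblingStep` owes only the forests' HARD CORES: the sub-lists of siblings that are neither.  Census-1's unconditional families are
statements about all-core forests: every forest of 3-chains `R[q](R[p](R[t]))` and glued children (`t = 1`) (g31 `sdec_threeChains_all`) and every one-shape
forest of glued siblings `R^lo[q](R^K[g])` with `lo < K ≤ 2lo` (g32 `sdec_shapeForests_all_twoLo`).  This file states the consequence in the node's own
shape: a forest is SDEC at a floor `0 < x < 1` as soon as EVERY sibling is either GOOD at `x` (law-OK, affordable `x·M ≤ q·mean`, and tame or hull+high) or a
member of ONE such core family (with its tree-OK floor condition `x ≤ q·g`, resp. `x ≤ q·p·t`).  No oracle, any width, any order.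
* **`sdec_append_good`** — adjoin a list of good siblings (each tame or hull+high) to an SDEC affordable law-OK forest.
* **`sdec_forest_twoLoCore`** — ∀ `lo < K ≤ 2lo`, ∀ `L : List Sib`: every `s ∈ L` good at `x`, or `s = ⟨q,·,·,lo+K,{lo:1−g, lo+K:g}⟩` with `0<q,g<1`,
  `x ≤ qg` ⟹ `SDEC x (ftop L) (flaw L)`.
* **`sdec_forest_threeChainCore`** — ∀ `L`: every `s ∈ L` good at `x`, or `s = ⟨q,·,·,3,{1:1−p, 2:p(1−t), 3:pt}⟩` with `0<q,p<1`, `0<t≤1`, `x ≤ qpt` ⟹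
  `SDEC x (ftop L) (flaw L)`.
(Tree-OK siblings are law-OK and affordable — `Sib.TreeOK.lawOK/afford`; which tree-OK siblings are tame / hull+high is census-1 g28/g29 and arm-1 g56/g57:
light or floored counts, 2-chains, cherries, no-positive-low laws, three-relay laws with C1 ∧ C2, ….)

HONEST STATUS.  Forests whose hard core MIXES shapes, or contains a glued sibling with `K > 2lo`, a 4-chain, …, stay open (arm-1 g58's `GluedDominatedMass` ⟸
`GluedLemmaW` is the general route); `SiblingStep`, `SDECConvClosed`, `FarTreeRow` OPEN; RATE class (log\*) / honest sentence of
`run/shared/lean/prim/quant/README.md` unchanged.  [this work].  Nothing here is cited as a published result.  The gluing rows served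
[cite: KozmaNitzan2024, Conjecture 3 (p. 15)]; product measure [cite: Grimmett1999, §1.3 p. 10].
-/

noncomputable section

open scoped BigOperators

namespace Summit.CriticalPhenomena.PercolationContinuityZ3.Theorems
namespace Quant
namespace LawDec

open Finset

/-- the 3-chain's sub-forest law `{1: 1−p, 2: p(1−s), 3: ps}` -/
local notation3 "CH[" p ", " s "]" => (fun h : ℕ => (1 - (p : ℝ)) * (if h = 1 then (1 : ℝ) else 0) +
  (p : ℝ) * (1 - (s : ℝ)) * (if h = 2 then (1 : ℝ) else 0) + (p : ℝ) * (s : ℝ) * (if h = 3 then (1 : ℝ) else 0))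

/-- the sub-forest law of the glued sibling of shape `(lo, K)`: `S(g) = {lo: 1−g, lo+K: g}` -/
local notation3 "SP[" lo ", " K ", " a "]" => (fun h : ℕ => (1 - (a : ℝ)) * (if h = (lo : ℕ) then (1 : ℝ) else 0) +
  (a : ℝ) * (if h = (lo : ℕ) + (K : ℕ) then (1 : ℝ) else 0))

/-! ### Adjoining good siblings -/

/-- **adjoin a list of GOOD siblings to an SDEC forest**: `Lc` law-OK, affordable, `SDEC x (ftop Lc) (flaw Lc)`; every `s ∈ Lg` law-OK, affordable and
TAME at `x` (every charged count `h ≥ 1` has `q·mean ≤ 2h` or `x(M−h) ≤ q·mean − h`) or with a HULL+HIGH decomposable gated law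
`HullHigh x (q·mean) M (gate ρ q)` ⟹ `SDEC x (ftop (Lg ++ Lc)) (flaw (Lg ++ Lc))` (iterated `sdec_cons_of_tame` / `sdec_cons_of_hullHigh`). [this work] -/
theorem sdec_append_good {x : ℝ} (hx0 : 0 < x) (hx1 : x < 1) (Lc : List Sib) (hLc : ∀ t ∈ Lc, t.LawOK)
    (hxLc : ∀ t ∈ Lc, x * (t.M : ℝ) ≤ t.q * t.mean) (hS : SDEC x (ftop Lc) (flaw Lc)) :
    ∀ Lg : List Sib, (∀ s ∈ Lg, s.LawOK) → (∀ s ∈ Lg, x * (s.M : ℝ) ≤ s.q * s.mean) →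
      (∀ s ∈ Lg, (∀ h : ℕ, 1 ≤ h → s.ρ h ≠ 0 → s.q * s.mean ≤ 2 * h ∨ x * ((s.M : ℝ) - h) ≤ s.q * s.mean - h) ∨
        HullHigh x (s.q * s.mean) s.M (gate s.ρ s.q)) →
      SDEC x (ftop (Lg ++ Lc)) (flaw (Lg ++ Lc))
  | [], _, _, _ => by simpa using hS
  | s :: Lg, hLg, hxLg, hgood => by
    have ih := sdec_append_good hx0 hx1 Lc hLc hxLc hS Lg (fun t ht => hLg t (List.mem_cons_of_mem s ht))
      (fun t ht => hxLg t (List.mem_cons_of_mem s ht)) (fun t ht => hgood t (List.mem_cons_of_mem s ht))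
    have hall : ∀ t ∈ Lg ++ Lc, t.LawOK := by
      intro t ht
      rcases List.mem_append.1 ht with h | h
      · exact hLg t (List.mem_cons_of_mem s h)
      · exact hLc t h
    have hxall : ∀ t ∈ Lg ++ Lc, x * (t.M : ℝ) ≤ t.q * t.mean := by
      intro t ht
      rcases List.mem_append.1 ht with h | h
      · exact hxLg t (List.mem_cons_of_mem s h)
      · exact hxLc t h
    rw [List.cons_append]
    rcases hgood s List.mem_cons_self with htame | hhh
    · exact sdec_cons_of_tame hx0 hx1 (Lg ++ Lc) s hall hxall ih (hLg s List.mem_cons_self) (hxLg s List.mem_cons_self) htame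
    · exact sdec_cons_of_hullHigh hx0 hx1 (Lg ++ Lc) s hall hxall ih hhh

/-- **splitting a forest into its good siblings and its hard core**: if every sibling is good at `x` or satisfies `core`, the core sub-list is
law-OK, affordable and SDEC, then the whole forest is SDEC (filter, adjoin the good ones, permute back). [this work] -/
theorem sdec_forest_of_core {x : ℝ} (hx0 : 0 < x) (hx1 : x < 1) (core : Sib → Prop) (L : List Sib)
    (hL : ∀ s ∈ L,
      (s.LawOK ∧ x * (s.M : ℝ) ≤ s.q * s.mean ∧
        ((∀ h : ℕ, 1 ≤ h → s.ρ h ≠ 0 → s.q * s.mean ≤ 2 * h ∨ x * ((s.M : ℝ) - h) ≤ s.q * s.mean - h) ∨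
          HullHigh x (s.q * s.mean) s.M (gate s.ρ s.q))) ∨ core s)
    (hcoreOK : ∀ s ∈ L, core s → s.LawOK ∧ x * (s.M : ℝ) ≤ s.q * s.mean)
    (hcoreS : ∀ Lc : List Sib, (∀ s ∈ Lc, s ∈ L ∧ core s) → SDEC x (ftop Lc) (flaw Lc)) :
    SDEC x (ftop L) (flaw L) := by
  classical
  set b : Sib → Bool := fun s => decide (core s) with hb
  set Lc := L.filter b with hLc
  set Lg := L.filter (fun s => !b s) with hLg
  have hperm : (Lg ++ Lc).Perm L := (List.perm_append_comm).trans (List.filter_append_perm b L)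
  refine sdec_flaw_perm hperm ?_
  have hcmem : ∀ s ∈ Lc, s ∈ L ∧ core s := by
    intro s hs
    obtain ⟨hsL, hbs⟩ := List.mem_filter.1 hs
    exact ⟨hsL, by simpa [hb] using hbs⟩
  have hgmem : ∀ s ∈ Lg, s ∈ L ∧ ¬ core s := by
    intro s hs
    obtain ⟨hsL, hbs⟩ := List.mem_filter.1 hs
    exact ⟨hsL, by simpa [hb] using hbs⟩
  have hgood : ∀ s ∈ Lg, s.LawOK ∧ x * (s.M : ℝ) ≤ s.q * s.mean ∧
      ((∀ h : ℕ, 1 ≤ h → s.ρ h ≠ 0 → s.q * s.mean ≤ 2 * h ∨ x * ((s.M : ℝ) - h) ≤ s.q * s.mean - h) ∨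
        HullHigh x (s.q * s.mean) s.M (gate s.ρ s.q)) := by
    intro s hs
    obtain ⟨hsL, hns⟩ := hgmem s hs
    rcases hL s hsL with h | h
    · exact h
    · exact absurd h hns
  exact sdec_append_good hx0 hx1 Lc (fun t ht => (hcoreOK t (hcmem t ht).1 (hcmem t ht).2).1)
    (fun t ht => (hcoreOK t (hcmem t ht).1 (hcmem t ht).2).2) (hcoreS Lc hcmem) Lg (fun s hs => (hgood s hs).1)
    (fun s hs => (hgood s hs).2.1) (fun s hs => (hgood s hs).2.2)

/-! ### Core = one-shape glued siblings, `K ≤ 2lo` -/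

/-- **THE SIBLING STEP FOR EVERY FOREST WHOSE HARD CORE IS A ONE-SHAPE FAMILY OF GLUED SIBLINGS `R^lo(R^K)`, `lo < K ≤ 2lo` — NO ORACLE, ANY WIDTH.**
For `0 < x < 1` and every sibling list `L` in which each `s` is GOOD at `x` (law-OK, `x·M ≤ q·mean`, tame or hull+high) or a glued sibling
`⟨q,·,·,lo+K,{lo: 1−g, lo+K: g}⟩` with `0 < q, g < 1` and `x ≤ qg`: `SDEC x (ftop L) (flaw L)`. [this work] -/
theorem sdec_forest_twoLoCore (lo K : ℕ) (hloK : lo < K) (hK2 : K ≤ 2 * lo) {x : ℝ} (hx0 : 0 < x) (hx1 : x < 1) (L : List Sib)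
    (hL : ∀ s ∈ L,
      (s.LawOK ∧ x * (s.M : ℝ) ≤ s.q * s.mean ∧
        ((∀ h : ℕ, 1 ≤ h → s.ρ h ≠ 0 → s.q * s.mean ≤ 2 * h ∨ x * ((s.M : ℝ) - h) ≤ s.q * s.mean - h) ∨
          HullHigh x (s.q * s.mean) s.M (gate s.ρ s.q))) ∨
      (s.M = lo + K ∧ 0 < s.q ∧ s.q < 1 ∧ ∃ g : ℝ, 0 < g ∧ g < 1 ∧ s.ρ = SP[lo, K, g] ∧ x ≤ s.q * g)) :
    SDEC x (ftop L) (flaw L) := by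
  refine sdec_forest_of_core hx0 hx1
    (fun s => s.M = lo + K ∧ 0 < s.q ∧ s.q < 1 ∧ ∃ g : ℝ, 0 < g ∧ g < 1 ∧ s.ρ = SP[lo, K, g] ∧ x ≤ s.q * g) L hL ?_ ?_
  · intro s _ hc
    obtain ⟨hM, hq0, hq1, g, hg0, hg1, hρ, hx⟩ := hc
    obtain ⟨c0, cM, c1, cm⟩ := sp_laws lo K hg0.le hg1.le
    have hmean : s.mean = (lo : ℝ) + K * g := by unfold Sib.mean; rw [hM, hρ]; exact cm
    refine ⟨⟨hq0, hq1, fun h => by rw [hρ]; exact c0 h, fun h hh => by rw [hρ]; exact cM h (by rw [hM] at hh; exact hh),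
      by rw [hM, hρ]; exact c1⟩, ?_⟩
    rw [hM, hmean]; push_cast
    have hB : (0 : ℝ) ≤ (lo : ℝ) + K := by positivity
    have h1 := mul_le_mul_of_nonneg_right hx hB
    have h2 : 0 ≤ s.q * (lo : ℝ) * (1 - g) := mul_nonneg (mul_nonneg hq0.le (Nat.cast_nonneg lo)) (by linarith)
    nlinarith
  · intro Lc hLc
    exact sdec_shapeForests_all_twoLo lo K hloK hK2 hx0 Lc (fun s hs => (hLc s hs).2)

/-! ### Core = 3-chains and glued children -/

/-- **THE SIBLING STEP FOR EVERY FOREST WHOSE HARD CORE IS A FAMILY OF 3-CHAINS `R[q](R[p](R[t]))` AND GLUED CHILDREN (`t = 1`) — NO ORACLE, ANY WIDTH.**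
For `0 < x < 1` and every sibling list `L` in which each `s` is GOOD at `x` or a 3-chain `⟨q,·,·,3,{1: 1−p, 2: p(1−t), 3: pt}⟩` with `0 < q, p < 1`,
`0 < t ≤ 1` and `x ≤ qpt`: `SDEC x (ftop L) (flaw L)` (core by census-1 g31's `sdec_threeChains_all`). [this work] -/
theorem sdec_forest_threeChainCore {x : ℝ} (hx0 : 0 < x) (hx1 : x < 1) (L : List Sib)
    (hL : ∀ s ∈ L,
      (s.LawOK ∧ x * (s.M : ℝ) ≤ s.q * s.mean ∧
        ((∀ h : ℕ, 1 ≤ h → s.ρ h ≠ 0 → s.q * s.mean ≤ 2 * h ∨ x * ((s.M : ℝ) - h) ≤ s.q * s.mean - h) ∨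
          HullHigh x (s.q * s.mean) s.M (gate s.ρ s.q))) ∨
      (s.M = 3 ∧ 0 < s.q ∧ s.q < 1 ∧ ∃ p t : ℝ, 0 < p ∧ p < 1 ∧ 0 < t ∧ t ≤ 1 ∧ s.ρ = CH[p, t] ∧ x ≤ s.q * (p * t))) :
    SDEC x (ftop L) (flaw L) := by
  refine sdec_forest_of_core hx0 hx1
    (fun s => s.M = 3 ∧ 0 < s.q ∧ s.q < 1 ∧ ∃ p t : ℝ, 0 < p ∧ p < 1 ∧ 0 < t ∧ t ≤ 1 ∧ s.ρ = CH[p, t] ∧ x ≤ s.q * (p * t)) L hL ?_ ?_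
  · intro s _ hc
    obtain ⟨hM, hq0, hq1, p, t, hp0, hp1, ht0, ht1, hρ, hx⟩ := hc
    obtain ⟨⟨c0, cM, c1, cm⟩, _⟩ := chain3_laws hq0.le hq1.le hp0.le hp1.le ht0.le ht1
    have hmean : s.mean = 1 + p + p * t := by unfold Sib.mean; rw [hM, hρ]; exact cm
    refine ⟨⟨hq0, hq1, fun h => by rw [hρ]; exact c0 h, fun h hh => by rw [hρ]; exact cM h (by rw [hM] at hh; exact hh),
      by rw [hM, hρ]; exact c1⟩, ?_⟩
    rw [hM, hmean]; push_cast
    have h1 : 0 ≤ s.q * (1 + p - 2 * p * t) := mul_nonneg hq0.le (by nlinarith)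
    nlinarith
  · intro Lc hLc
    exact sdec_threeChains_all hx0 Lc (fun s hs => (hLc s hs).2)

end LawDec
end Quant
end Summit.CriticalPhenomena.PercolationContinuityZ3.Theorems
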